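import Literature.Topology.FourManifolds.OneHandleStepContext
import Literature.Topology.FourManifolds.OrientedConnectedSumExistence
import Literature.Topology.FourManifolds.SmoothOrientationDiffeomorphProofs
import Literature.Topology.FourManifolds.OrientationDiffeotopy
import HarnessLib

/-!
# The handle-extension step for one `1`-handle: a criterion for the matching condition

Topic `Literature/Topology/FourManifolds` (fact seat
`provefact-Literature.Topology.FourManifolds.IsHandlebody.exists_diffeomorph_isBoundaryGluing_sphere`,
step F2b₁ of the Lickorish–Wallace DAG; assembly of the level step H, continued from
`OneHandleStepContext.lean`).  Everything here is **proved**; no named facts.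

The matching condition `C.Match` of a context compares the characters, in the seed level of
`M'`, of the `+` discs `Ψ ∘ Λ ∘ (lifted foot)` and `Λ' ∘ (lifted foot')`.  Since the flows `Λ`,
`Λ'` preserve the canonical level orientations (`LevelFlowOrientation.lean`) and the seed
level map `Ψ` either preserves or reverses them (Hirsch's dichotomy on the connected seed
level, `Diffeomorph.isOrientationPreserving_or_isOrientationReversing_holds`), the condition
reduces to **flow-independent data**: `Match` holds as soon as, for one model orientation `o₀`,
`Ψ` preserves the canonical orientations iff the lifted `+` feet of the two sides have the
same character for the canonical orientations of their own levels
(`OneHandleStepContext.match_of_decision`).  This is what lets the assembly decide whether to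
reflect the Morse chart of `M'` *before* the fields and flows are built.

## References

* M. W. Hirsch, *Differential Topology*, GTM 33 (1976), Ch. 4 §4, pp. 100–103. [HirschDT1976]
* A. A. Kosinski, *Differential Manifolds* (1993), VI (6.6). [Kosinski1993]
-/

open scoped Manifold ContDiff Topology
open Set Function Filter Metric Module

noncomputable section

namespace Literature.Topology.FourManifolds

universe u

/-- Local notation: `𝔼 n` is the model Euclidean space `EuclideanSpace ℝ (Fin n)`. -/
local notation "𝔼 " n:arg => EuclideanSpace ℝ (Fin n)

/-! ### Orientation bookkeeping -/

section Bookkeeping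

variable {E : Type*} [NormedAddCommGroup E] [NormedSpace ℝ E] [FiniteDimensional ℝ E]
  {H₁ H₂ : Type*} [TopologicalSpace H₁] [TopologicalSpace H₂]
  {I₁ : ModelWithCorners ℝ E H₁} {I₂ : ModelWithCorners ℝ E H₂}
  {V₁ V₂ : Type*} [TopologicalSpace V₁] [ChartedSpace H₁ V₁] [IsManifold I₁ 1 V₁]
  [TopologicalSpace V₂] [ChartedSpace H₂ V₂] [IsManifold I₂ 1 V₂]

/-- **The source orientation making a map orientation preserving is unique.**
[cite: HirschDT1976, §4.4 p. 101] -/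
theorem eq_of_isOrientationPreserving {o₁ o₂ : SmoothOrientation I₁ V₁} {o' : SmoothOrientation I₂ V₂} {Φ : V₁ → V₂}
    (h₁ : IsOrientationPreserving o₁ o' Φ) (h₂ : IsOrientationPreserving o₂ o' Φ) : o₁ = o₂ := by
  ext x
  have e1 := h₁ x; have e2 := h₂ x
  by_cases hd : 0 < LinearMap.det (M := E) (mfderiv I₁ I₂ Φ x).toLinearMap
  · exact (e1.2 hd).symm.trans (e2.2 hd)
  · have a1 : o' (Φ x) ≠ o₁ x := fun h' => hd (e1.1 h')
    have a2 : o' (Φ x) ≠ o₂ x := fun h' => hd (e2.1 h')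
    have b1 : o' (Φ x) = -o₁ x := (Orientation.eq_or_eq_neg (o' (Φ x)) (o₁ x) (Fintype.card_fin _)).resolve_left a1
    have b2 : o' (Φ x) = -o₂ x := (Orientation.eq_or_eq_neg (o' (Φ x)) (o₂ x) (Fintype.card_fin _)).resolve_left a2
    exact neg_inj.1 (b1.symm.trans b2)

/-- Propositional bookkeeping. [folklore] -/
theorem not_iff_left_of_not_iff {A B : Prop} (h : ¬ (A ↔ B)) : (¬ A ↔ B) := by tauto

/-- Propositional bookkeeping. [folklore] -/
theorem iff_not_right_of_not_iff {A B : Prop} (h : ¬ (A ↔ B)) : (A ↔ ¬ B) := by tauto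

end Bookkeeping

section Levels

variable {n : ℕ} {V₁ V₂ : Type*} [TopologicalSpace V₁] [ChartedSpace (𝔼 n) V₁] [IsManifold (𝓡 n) ∞ V₁]
  [TopologicalSpace V₂] [ChartedSpace (𝔼 n) V₂] [IsManifold (𝓡 n) ∞ V₂]

/-- **Characters after an orientation-preserving diffeomorphism of levels are the characters
before it.** [cite: HirschDT1976, §4.4 p. 103] -/
theorem isOrientationPreserving_comp_iff_of_isOrientationPreserving (Φ : V₁ ≃ₘ⟮𝓡 n, 𝓡 n⟯ V₂)
    {o₁ : SmoothOrientation (𝓡 n) V₁} {o₂ : SmoothOrientation (𝓡 n) V₂} (hΦ : Φ.IsOrientationPreserving o₁ o₂)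
    {e : 𝔼 n → V₁} (he : MDifferentiable 𝓘(ℝ, 𝔼 n) (𝓡 n) e)
    (hdet : ∀ w, LinearMap.det (M := 𝔼 n) (mfderiv 𝓘(ℝ, 𝔼 n) (𝓡 n) e w).toLinearMap ≠ 0)
    (o₀ : Orientation ℝ (𝔼 n) (Fin (finrank ℝ (𝔼 n)))) :
    IsOrientationPreserving (SmoothOrientation.modelSpace o₀) o₂ (Φ ∘ e) ↔
      IsOrientationPreserving (SmoothOrientation.modelSpace o₀) o₁ e := by
  rw [isOrientationPreserving_comp_iff_of_diffeomorph Φ o₂ he hdet]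
  have hn' : (∞ : ℕ∞ω) ≠ 0 := by simp
  rw [eq_of_isOrientationPreserving (SmoothOrientation.isOrientationPreserving_comapOfDetNeZero o₂ Φ Φ.contMDiff hn'
    (Φ.det_mfderiv_ne_zero hn')) hΦ]

/-- **Characters after an orientation-reversing diffeomorphism of levels are the characters
before it for the opposite model orientation.** [cite: HirschDT1976, §4.4 p. 103] -/
theorem isOrientationPreserving_comp_iff_of_isOrientationReversing (Φ : V₁ ≃ₘ⟮𝓡 n, 𝓡 n⟯ V₂)
    {o₁ : SmoothOrientation (𝓡 n) V₁} {o₂ : SmoothOrientation (𝓡 n) V₂} (hΦ : Φ.IsOrientationReversing o₁ o₂)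
    {e : 𝔼 n → V₁} (he : MDifferentiable 𝓘(ℝ, 𝔼 n) (𝓡 n) e)
    (hdet : ∀ w, LinearMap.det (M := 𝔼 n) (mfderiv 𝓘(ℝ, 𝔼 n) (𝓡 n) e w).toLinearMap ≠ 0)
    (o₀ : Orientation ℝ (𝔼 n) (Fin (finrank ℝ (𝔼 n)))) :
    IsOrientationPreserving (SmoothOrientation.modelSpace o₀) o₂ (Φ ∘ e) ↔
      IsOrientationPreserving (SmoothOrientation.modelSpace (-o₀)) o₁ e := by
  -- `Φ` preserves `(-o₁, o₂)`
  have hΦ' : Φ.IsOrientationPreserving (-o₁) o₂ := by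
    have h : IsOrientationPreserving o₁ (-o₂) Φ := hΦ
    rw [← isOrientationPreserving_neg_neg_iff, neg_neg] at h; exact h
  rw [isOrientationPreserving_comp_iff_of_isOrientationPreserving Φ hΦ' he hdet o₀,
    ← isOrientationPreserving_neg_neg_iff, SmoothOrientation.neg_modelSpace, neg_neg]

/-- **A disc has exactly one of the two characters.** [cite: HirschDT1976, §4.4 p. 101] -/
theorem isOrientationPreserving_neg_iff_not {i : 𝔼 n → V₁} (hi : Manifold.IsSmoothEmbedding 𝓘(ℝ, 𝔼 n) (𝓡 n) ∞ i)
    (ho : IsOpen (range i)) (oV : SmoothOrientation (𝓡 n) V₁) (o₀ : Orientation ℝ (𝔼 n) (Fin (finrank ℝ (𝔼 n)))) :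
    IsOrientationPreserving (SmoothOrientation.modelSpace (-o₀)) oV i ↔ ¬ IsOrientationPreserving (SmoothOrientation.modelSpace o₀) oV i := by
  have hrev : IsOrientationPreserving (SmoothOrientation.modelSpace (-o₀)) oV i ↔ IsOrientationReversing (SmoothOrientation.modelSpace o₀) oV i := by
    rw [isOrientationReversing_iff_neg, SmoothOrientation.neg_modelSpace]
  rw [hrev]
  constructor
  · intro h hp; exact hp.not_isOrientationReversing h
  · intro h
    rcases isOrientationPreserving_or_isOrientationReversing_disc hi ho o₀ oV with h' | h'
    · exact (h h').elim
    · exact h'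

end Levels

/-! ### The criterion -/

namespace OneHandleStepContext

variable {n : ℕ} {M : Type u} [TopologicalSpace M] [ChartedSpace (EuclideanHalfSpace (n + 1)) M]
  [IsManifold (𝓡∂ (n + 1)) ∞ M]
  {M' : Type u} [TopologicalSpace M'] [ChartedSpace (EuclideanHalfSpace (n + 1)) M'] [IsManifold (𝓡∂ (n + 1)) ∞ M']
  (C : OneHandleStepContext n M M')

/-- The canonical orientation of the foot level of `M`. [cite: HirschDT1976, §4.4 p. 103] -/
def oFoot : SmoothOrientation (𝓡 n) (C.Sl.Level (C.S.f C.S.p - C.m)) := C.Sl.levelOrientation rfl C.oM C.hn1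

/-- The canonical orientation of the foot level of `M'`. [cite: HirschDT1976, §4.4 p. 103] -/
def oFoot' : SmoothOrientation (𝓡 n) (C.Sl'.Level (C.S'.f C.S'.p - C.m')) := C.Sl'.levelOrientation rfl C.oM' C.hn1

/-- The canonical orientation of the seed level of `M`. [cite: HirschDT1976, §4.4 p. 103] -/
def oSeed : SmoothOrientation (𝓡 n) (C.Sl.Level C.c) := C.Sl.levelOrientation rfl C.oM C.hn1

/-- **The character of the lifted `+` foot of `M`** for the model orientation `o₀` and the
canonical orientation of its level. [cite: Kosinski1993, VI (6.6)] -/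
structure FootChar (o₀ : Orientation ℝ (𝔼 n) (Fin (finrank ℝ (𝔼 n)))) : Prop where
  /-- The lifted `+` foot preserves `(o₀, oFoot)`. -/
  pres : IsOrientationPreserving (SmoothOrientation.modelSpace o₀) C.oFoot (C.T.footLift C.ρ_pos C.hmR (one_pow 2))

/-- The character of the lifted `+` foot of `M'`. [cite: Kosinski1993, VI (6.6)] -/
structure FootChar' (o₀ : Orientation ℝ (𝔼 n) (Fin (finrank ℝ (𝔼 n)))) : Prop where
  /-- The lifted `+` foot of `M'` preserves `(o₀, oFoot')`. -/
  pres : IsOrientationPreserving (SmoothOrientation.modelSpace o₀) C.oFoot' (C.T'.footLift C.ρ_pos C.hmR' (one_pow 2))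

/-- **The seed level map preserves the canonical orientations.** [cite: HirschDT1976, §4.4 p. 101] -/
structure SeedPres : Prop where
  /-- `Ψ` preserves `(oSeed, oV')`. -/
  pres : C.Ψlev.IsOrientationPreserving C.oSeed C.oV'

/-- Unfolding. [folklore] -/
theorem footChar_iff (o₀ : Orientation ℝ (𝔼 n) (Fin (finrank ℝ (𝔼 n)))) :
    C.FootChar o₀ ↔ IsOrientationPreserving (SmoothOrientation.modelSpace o₀) C.oFoot (C.T.footLift C.ρ_pos C.hmR (one_pow 2)) :=
  ⟨fun h => h.1, fun h => ⟨h⟩⟩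

/-- Unfolding. [folklore] -/
theorem footChar'_iff (o₀ : Orientation ℝ (𝔼 n) (Fin (finrank ℝ (𝔼 n)))) :
    C.FootChar' o₀ ↔ IsOrientationPreserving (SmoothOrientation.modelSpace o₀) C.oFoot' (C.T'.footLift C.ρ_pos C.hmR' (one_pow 2)) :=
  ⟨fun h => h.1, fun h => ⟨h⟩⟩

/-- Unfolding. [folklore] -/
theorem seedPres_iff : C.SeedPres ↔ C.Ψlev.IsOrientationPreserving C.oSeed C.oV' := ⟨fun h => h.1, fun h => ⟨h⟩⟩

/-- The lifted feet are differentiable. [folklore] -/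
theorem mdifferentiable_footLift {s : ℝ} (hs : s ^ 2 = 1) : MDifferentiable 𝓘(ℝ, 𝔼 n) (𝓡 n) (C.T.footLift C.ρ_pos C.hmR hs) :=
  (C.T.isSmoothEmbedding_footLift C.ρ_pos C.hmR hs).contMDiff.mdifferentiable (by simp)

/-- The lifted feet of `M'` are differentiable. [folklore] -/
theorem mdifferentiable_footLift' {s : ℝ} (hs : s ^ 2 = 1) : MDifferentiable 𝓘(ℝ, 𝔼 n) (𝓡 n) (C.T'.footLift C.ρ_pos C.hmR' hs) :=
  (C.T'.isSmoothEmbedding_footLift C.ρ_pos C.hmR' hs).contMDiff.mdifferentiable (by simp)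

/-- **The character of `disc' 1` is the character of the lifted foot of `M'`.**
[cite: HirschDT1976, §4.4 p. 103] -/
theorem disc'_char_iff (o₀ : Orientation ℝ (𝔼 n) (Fin (finrank ℝ (𝔼 n)))) :
    IsOrientationPreserving (SmoothOrientation.modelSpace o₀) C.oV' (C.disc' (one_pow 2)) ↔ C.FootChar' o₀ := by
  rw [C.disc'_def, C.footChar'_iff]
  exact isOrientationPreserving_comp_iff_of_isOrientationPreserving C.Λ'
    (C.Sl'.levelFlowDiffeomorph_isOrientationPreserving rfl rfl C.foot_mem' C.c'_mem C.oM' C.hn1)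
    (C.mdifferentiable_footLift' (one_pow 2)) (C.T'.det_mfderiv_footLift_ne_zero C.ρ_pos C.hmR' (one_pow 2)) o₀

/-- The character of `Λ ∘ footLift` is the character of the lifted foot of `M`. [cite: HirschDT1976, §4.4 p. 103] -/
theorem flow_footLift_char_iff (o₀ : Orientation ℝ (𝔼 n) (Fin (finrank ℝ (𝔼 n)))) :
    IsOrientationPreserving (SmoothOrientation.modelSpace o₀) C.oSeed (C.Λ ∘ C.T.footLift C.ρ_pos C.hmR (one_pow 2)) ↔ C.FootChar o₀ :=
  Iff.trans (b := IsOrientationPreserving (SmoothOrientation.modelSpace o₀) C.oFoot (C.T.footLift C.ρ_pos C.hmR (one_pow 2)))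
    (isOrientationPreserving_comp_iff_of_isOrientationPreserving C.Λ
    (C.Sl.levelFlowDiffeomorph_isOrientationPreserving rfl rfl C.foot_mem C.c_mem C.oM C.hn1)
    (C.mdifferentiable_footLift (one_pow 2)) (C.T.det_mfderiv_footLift_ne_zero C.ρ_pos C.hmR (one_pow 2)) o₀) (C.footChar_iff o₀).symm

/-- **The character of `disc 1` when the seed map preserves the canonical orientations.**
[cite: HirschDT1976, §4.4 p. 103] -/
theorem disc_char_iff_of_seedPres (hP : C.SeedPres) (o₀ : Orientation ℝ (𝔼 n) (Fin (finrank ℝ (𝔼 n)))) :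
    IsOrientationPreserving (SmoothOrientation.modelSpace o₀) C.oV' (C.disc (one_pow 2)) ↔ C.FootChar o₀ := by
  have hn' : (∞ : ℕ∞ω) ≠ 0 := by simp
  rw [C.disc_def, ← C.flow_footLift_char_iff o₀]
  exact isOrientationPreserving_comp_iff_of_isOrientationPreserving C.Ψlev hP.1
    ((C.Λ.mdifferentiable hn').comp (C.mdifferentiable_footLift (one_pow 2)))
    (det_mfderiv_diffeomorph_comp_ne_zero C.Λ (C.mdifferentiable_footLift (one_pow 2)) (C.T.det_mfderiv_footLift_ne_zero C.ρ_pos C.hmR (one_pow 2))) o₀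

/-- **The character of `disc 1` when the seed map reverses the canonical orientations.**
[cite: HirschDT1976, §4.4 p. 103] -/
theorem disc_char_iff_of_not_seedPres (hP : ¬ C.SeedPres) (o₀ : Orientation ℝ (𝔼 n) (Fin (finrank ℝ (𝔼 n)))) :
    IsOrientationPreserving (SmoothOrientation.modelSpace o₀) C.oV' (C.disc (one_pow 2)) ↔ C.FootChar (-o₀) := by
  have hn' : (∞ : ℕ∞ω) ≠ 0 := by simp
  have hrev : C.Ψlev.IsOrientationReversing C.oSeed C.oV' :=
    (Diffeomorph.isOrientationPreserving_or_isOrientationReversing_holds C.Ψlev hn' C.oSeed C.oV').resolve_left fun h => hP ⟨h⟩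
  rw [C.disc_def, ← C.flow_footLift_char_iff (-o₀)]
  exact isOrientationPreserving_comp_iff_of_isOrientationReversing C.Ψlev hrev
    ((C.Λ.mdifferentiable hn').comp (C.mdifferentiable_footLift (one_pow 2)))
    (det_mfderiv_diffeomorph_comp_ne_zero C.Λ (C.mdifferentiable_footLift (one_pow 2)) (C.T.det_mfderiv_footLift_ne_zero C.ρ_pos C.hmR (one_pow 2))) o₀

/-- The lifted foot of `M` has exactly one character. [cite: HirschDT1976, §4.4 p. 101] -/
theorem footChar_neg_iff (o₀ : Orientation ℝ (𝔼 n) (Fin (finrank ℝ (𝔼 n)))) : C.FootChar (-o₀) ↔ ¬ C.FootChar o₀ := by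
  rw [C.footChar_iff, C.footChar_iff]
  exact isOrientationPreserving_neg_iff_not (C.T.isSmoothEmbedding_footLift C.ρ_pos C.hmR (one_pow 2)) (C.isOpen_range_footLift (one_pow 2)) _ o₀

/-- The lifted foot of `M'` has exactly one character. [cite: HirschDT1976, §4.4 p. 101] -/
theorem footChar'_neg_iff (o₀ : Orientation ℝ (𝔼 n) (Fin (finrank ℝ (𝔼 n)))) : C.FootChar' (-o₀) ↔ ¬ C.FootChar' o₀ := by
  rw [C.footChar'_iff, C.footChar'_iff]
  exact isOrientationPreserving_neg_iff_not (C.T'.isSmoothEmbedding_footLift C.ρ_pos C.hmR' (one_pow 2)) (C.isOpen_range_footLift' (one_pow 2)) _ o₀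

/-- **The decision criterion**: if, for one model orientation, the seed map preserves the
canonical orientations iff the lifted `+` feet of the two sides have the same character, then
the `+` discs match. [cite: Kosinski1993, VI (6.6)] -/
theorem match_of_decision (o₀ : Orientation ℝ (𝔼 n) (Fin (finrank ℝ (𝔼 n))))
    (h : C.SeedPres ↔ (C.FootChar o₀ ↔ C.FootChar' o₀)) : C.Match := by
  refine ⟨fun o => ?_⟩
  rw [C.disc'_char_iff]
  by_cases hP : C.SeedPres
  · rw [C.disc_char_iff_of_seedPres hP]
    have h0 := h.1 hP
    rcases Orientation.eq_or_eq_neg o o₀ (Fintype.card_fin _) with ho | ho <;> rw [ho]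
    · exact h0
    · exact (C.footChar_neg_iff o₀).trans ((not_congr h0).trans (C.footChar'_neg_iff o₀).symm)
  · rw [C.disc_char_iff_of_not_seedPres hP]
    have h0 : ¬ (C.FootChar o₀ ↔ C.FootChar' o₀) := fun h' => hP (h.2 h')
    rcases Orientation.eq_or_eq_neg o o₀ (Fintype.card_fin _) with ho | ho <;> rw [ho]
    · exact (C.footChar_neg_iff o₀).trans (not_iff_left_of_not_iff h0)
    · have e : C.FootChar (-(-o₀)) ↔ C.FootChar o₀ := by rw [neg_neg o₀]
      exact e.trans ((iff_not_right_of_not_iff h0).trans (C.footChar'_neg_iff o₀).symm)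

end OneHandleStepContext

end Literature.Topology.FourManifolds
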